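import Mathlib
import Summits.NavierStokesRegularity.NavierStokesRegularity.Theorems.EulerZoomLiouvillePowerGaugeEulerLiouvilleSelfSimilarSwirlRatchet
import HarnessLib

/-!
# Crux E `PowerGaugeEulerLiouville` (stmt-NavierStokesRegularity-19832), THE ONE STATEMENT `stub_selfSimilarC2Needle`: SWIRL PIERCING — on every sphere beyond
# the swirl onset an axisymmetric profile carries a STRICT-INFLOW point where `|r V_θ|` is maximal over the ball (width seat ns-ezl-w3 g3)

Route №10 `EulerZoomLiouville` (NavierStokesRegularity), crux E; LEAD ns-typeII-p2 g12.  Portrait lemma for the axisymmetric residue (N4′) of THE ONE STATEMENT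
(«about no axis axisymmetric with tame swirl» — i.e. the surviving axisymmetric needle HAS swirl, unbounded and fat-tailed): the swirl ratchet `DΓ[W] = −(1−2γ)Γ`
(`SwirlRatchet.fderiv_swirl_transport`, p640471; `Γ = swirl V = rV_θ`, `W = γy + V`, `γ < ½`) and Fermat's theorem on the closed ball give, with NO growth, tameness or
pressure hypothesis:

* `swirlMax_boundary_inflow` — if `a` maximises `Γ²` over the closed ball `‖y‖ ≤ R` and `Γ(a) ≠ 0`, then `‖a‖ = R` (an interior maximum has `∇Γ(a) = 0`, contradicting
  `DΓ(a)[W(a)] = −(1−2γ)Γ(a) ≠ 0`) and `⟪a, W(a)⟫ < 0` STRICTLY (Fermat on the ball: `D(Γ²)(a)` kills `a^⊥` and is `≥ 0` on `a`, so `D(Γ²)(a)[W] = λ⟪a,W⟫` with `λ ≥ 0`,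
  while `D(Γ²)(a)[W] = −2(1−2γ)Γ(a)² < 0`).
* `exists_swirlMax_inflow` / `swirl_piercing` — for every radius `R` beyond the swirl onset the sphere `S_R` carries a point `a` with `|Γ| ≤ |Γ(a)|` on the whole ball,
  `Γ(a) ≠ 0` (so `a` is off the axis), `⟪a, W(a)⟫ < 0`, i.e. `⟪a, V(a)⟫ < −γR²` — a FAST-INFLOW point in the sense of `HasBernoulliPiercing` (`⟪y, V y⟫ ≤ −‖y‖²/(2+ρ)`)
  carrying the maximal swirl, `|V(a)| > γR`;
* `swirlMax_lt_of_lt` — the ball maximum of `|Γ|` is STRICTLY increasing in the radius beyond the onset.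

So in the axisymmetric needle the SWIRL CHANNEL IS AN INFLOW CHANNEL: the (N1) fast-inflow points of the portrait can be taken to be the swirl maxima.
WHAT THIS IS NOT: not NS regularity, not the crux E, not a kill — a portrait lemma for the registered residue of the crux CLASS 19832 (MODEL lattice; E/NS strata),
`--supports` stmt-19832; 19832 OPEN. [cite: Chae2007CMPEuler, Thm 2.2 + Note added p. 6 (the swirl transport); ConstantinIgnatovaVicol2026Putative §3.4.3]
-/

noncomputable section

-- flat `Theorems/<Route><Decl>…` files of one crux share the namespace of the crux (tree convention: `Summit.<S>.<S>.…`)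
set_option linter.dupNamespace false

open MeasureTheory Set Filter Topology Metric Function InnerProductSpace
open scoped RealInnerProductSpace NNReal ContDiff

namespace Summit.NavierStokesRegularity.NavierStokesRegularity.Theorems.PowerGaugeEulerLiouville

open Literature.Analysis Literature.Analysis.FluidPDE Literature.Analysis.FunctionSpaces

namespace SwirlRatchet

variable {γ : ℝ} {U : EuclideanSpace ℝ (Fin 3) → EuclideanSpace ℝ (Fin 3)} {P : EuclideanSpace ℝ (Fin 3) → ℝ}

/-- A strictly inward direction at a point of the closed ball: a short segment along it stays in the ball, so a positive multiple of it lies in the positive tangent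
cone (Fermat set-up). [folklore] -/
theorem exists_smul_mem_posTangentConeAt_closedBall {R : ℝ} {a v : EuclideanSpace ℝ (Fin 3)} (ha : a ∈ closedBall (0 : EuclideanSpace ℝ (Fin 3)) R)
    (hv : ⟪v, a⟫ < 0) : ∃ t : ℝ, 0 < t ∧ t • v ∈ posTangentConeAt (closedBall (0 : EuclideanSpace ℝ (Fin 3)) R) a := by
  have hv0 : v ≠ 0 := fun h0 => by rw [h0, inner_zero_left] at hv; exact lt_irrefl _ hv
  have hvn : 0 < ‖v‖ ^ 2 := by positivity
  set t : ℝ := -⟪a, v⟫ / ‖v‖ ^ 2 with ht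
  have hav : ⟪a, v⟫ < 0 := by rwa [real_inner_comm]
  have ht0 : 0 < t := by rw [ht]; exact div_pos (by linarith) hvn
  refine ⟨t, ht0, mem_posTangentConeAt_of_segment_subset ((convex_closedBall _ _).segment_subset ha ?_)⟩
  -- `a + t v` is in the ball: `‖a + t v‖² = ‖a‖² + t⟪a,v⟫ ≤ ‖a‖²`
  have haR : ‖a‖ ≤ R := mem_closedBall_zero_iff.1 ha
  have hsq : ‖a + t • v‖ ^ 2 ≤ ‖a‖ ^ 2 := by
    rw [norm_add_sq_real, inner_smul_right, norm_smul, mul_pow, Real.norm_eq_abs, sq_abs]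
    have h1 : t ^ 2 * ‖v‖ ^ 2 = -(t * ⟪a, v⟫) := by
      rw [ht]; field_simp
    nlinarith [mul_pos ht0 (neg_pos.2 hav)]
  have hle : ‖a + t • v‖ ≤ ‖a‖ := by
    exact (pow_le_pow_iff_left₀ (norm_nonneg _) (norm_nonneg _) two_ne_zero).1 hsq
  exact mem_closedBall_zero_iff.2 (hle.trans haR)

/-- **THE SWIRL MAXIMUM OVER A BALL SITS ON THE SPHERE AT A STRICT-INFLOW POINT.**  `(U, P)` a `C²` self-similar Euler profile (CIV (3.3)), `U` axisymmetric, `γ < ½`;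
if `a` maximises `Γ² = (rU_θ)²` over the closed ball `‖y‖ ≤ R` and `Γ(a) ≠ 0`, then `‖a‖ = R` and `⟪a, γa + U a⟫ < 0`.  (Interior maximum ⇒ `∇Γ(a) = 0`, but
`DΓ(a)[W] = −(1−2γ)Γ(a) ≠ 0`; on the sphere, Fermat's theorem on the ball makes `D(Γ²)(a)` vanish on `a^⊥` and be `≥ 0` on `a`, whereas `D(Γ²)(a)[W] = −2(1−2γ)Γ(a)² < 0`.)
[cite: Chae2007CMPEuler, Thm 2.2 + Note added p. 6] -/
theorem swirlMax_boundary_inflow (h : IsSelfSimilarEulerProfile γ 0 U P) (hU : IsAxisymmetric U) (hγ2 : γ < 1 / 2)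
    {R : ℝ} {a : EuclideanSpace ℝ (Fin 3)} (ha : a ∈ closedBall (0 : EuclideanSpace ℝ (Fin 3)) R)
    (hmax : IsMaxOn (fun y => swirl U y ^ 2) (closedBall (0 : EuclideanSpace ℝ (Fin 3)) R) a) (hΓ : swirl U a ≠ 0) :
    ‖a‖ = R ∧ ⟪a, selfSimilarTransport γ 0 U a⟫ < 0 := by
  have hΓd : Differentiable ℝ (swirl U) := (contDiff_swirl h.contDiff_velocity).differentiable (by norm_num)
  set L : EuclideanSpace ℝ (Fin 3) →L[ℝ] ℝ := fderiv ℝ (swirl U) a with hL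
  set f' : EuclideanSpace ℝ (Fin 3) →L[ℝ] ℝ := (2 * swirl U a) • L with hf'
  have hf : HasFDerivAt (fun y => swirl U y ^ 2) f' a := by
    have h1 := (hΓd a).hasFDerivAt.pow 2
    simpa [hf', hL, pow_one] using h1
  set Wa : EuclideanSpace ℝ (Fin 3) := selfSimilarTransport γ 0 U a with hWa
  -- the ratchet at `a`
  have hLW : L Wa = -((1 - 2 * γ) * swirl U a) := fderiv_swirl_transport h hU a
  have hΓ2 : 0 < swirl U a ^ 2 := by positivity
  have hneg : f' Wa < 0 := by
    have e : f' Wa = -(2 * (1 - 2 * γ) * swirl U a ^ 2) := by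
      have e1 : f' Wa = (2 * swirl U a) * L Wa := by rw [hf']; rfl
      rw [e1, hLW]; ring
    rw [e]
    have : 0 < 1 - 2 * γ := by linarith
    nlinarith
  have hloc : IsLocalMaxOn (fun y => swirl U y ^ 2) (closedBall (0 : EuclideanSpace ℝ (Fin 3)) R) a := hmax.localize
  -- Fermat along strictly inward directions
  have hin : ∀ v : EuclideanSpace ℝ (Fin 3), ⟪v, a⟫ < 0 → f' v ≤ 0 := by
    intro v hv
    obtain ⟨t, ht0, htv⟩ := exists_smul_mem_posTangentConeAt_closedBall ha hv
    have h1 := hloc.hasFDerivWithinAt_nonpos hf.hasFDerivWithinAt htv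
    rw [map_smul, smul_eq_mul] at h1
    exact nonpos_of_mul_nonpos_right h1 ht0
  -- (A) the maximum is on the sphere
  have haR : ‖a‖ ≤ R := mem_closedBall_zero_iff.1 ha
  have hR : ‖a‖ = R := by
    by_contra hne
    have hlt : ‖a‖ < R := lt_of_le_of_ne haR hne
    have hnhds : closedBall (0 : EuclideanSpace ℝ (Fin 3)) R ∈ 𝓝 a :=
      Filter.mem_of_superset (isOpen_ball.mem_nhds (mem_ball_zero_iff.2 hlt)) ball_subset_closedBall
    have h0 := (hloc.isLocalMax hnhds).hasFDerivAt_eq_zero hf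
    rw [h0] at hneg
    simp at hneg
  refine ⟨hR, ?_⟩
  have ha0 : a ≠ 0 := by
    intro h0
    apply hΓ
    rw [h0]
    simp [swirl]
  have hR0 : 0 < R := by rw [← hR]; exact norm_pos_iff.2 ha0
  have haa : ⟪a, a⟫ = R ^ 2 := by rw [real_inner_self_eq_norm_sq, hR]
  -- (B1) `f' a ≥ 0` (the inward direction `−a`)
  have hfa : 0 ≤ f' a := by
    have h1 := hin (-a) (by rw [inner_neg_left, haa]; linarith [pow_pos hR0 2])
    rw [map_neg] at h1
    linarith
  -- (B2) `f'` vanishes on `a^⊥` (inward perturbations `v − εa`, then `ε ↓ 0`, for `v` and `−v`)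
  have hperp : ∀ v : EuclideanSpace ℝ (Fin 3), ⟪v, a⟫ = 0 → f' v = 0 := by
    have hle : ∀ v : EuclideanSpace ℝ (Fin 3), ⟪v, a⟫ = 0 → f' v ≤ 0 := by
      intro v hv
      have hε : ∀ ε : ℝ, 0 < ε → f' v ≤ ε * f' a := by
        intro ε hε
        have h1 := hin (v - ε • a) (by rw [inner_sub_left, real_inner_smul_left, hv, haa]; nlinarith [pow_pos hR0 2])
        rw [map_sub, map_smul, smul_eq_mul] at h1
        linarith
      refine le_of_not_gt fun hpos => ?_
      have h2 := hε (f' v / (2 * (f' a + 1))) (by positivity)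
      have h3 : f' v / (2 * (f' a + 1)) * f' a < f' v := by
        rw [div_mul_eq_mul_div, div_lt_iff₀ (by positivity)]
        nlinarith
      linarith
    intro v hv
    refine le_antisymm (hle v hv) ?_
    have h1 := hle (-v) (by rw [inner_neg_left, hv, neg_zero])
    rw [map_neg] at h1
    linarith
  -- (B3) decompose `W(a) = (W(a) − c a) + c a`, `c = ⟪a, W(a)⟫/R²`, and conclude
  refine lt_of_not_ge fun hge => ?_
  set c : ℝ := ⟪a, Wa⟫ / R ^ 2 with hc
  have hcR : c * R ^ 2 = ⟪a, Wa⟫ := by rw [hc]; field_simp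
  have hperpW : ⟪Wa - c • a, a⟫ = 0 := by
    rw [inner_sub_left, real_inner_smul_left, haa, hcR, real_inner_comm, sub_self]
  have hdecomp : f' Wa = c * f' a := by
    have h1 := hperp _ hperpW
    rw [map_sub, map_smul, smul_eq_mul] at h1
    linarith
  have hc0 : 0 ≤ c := by rw [hc]; exact div_nonneg hge (by positivity)
  have : 0 ≤ f' Wa := by rw [hdecomp]; exact mul_nonneg hc0 hfa
  linarith

/-- **SWIRL PIERCING, ONE BALL**: if the swirl does not vanish identically on the closed ball `‖y‖ ≤ R`, the sphere `S_R` carries a point `a` where `|Γ|` is maximal over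
the ball, `Γ(a) ≠ 0`, `⟪a, γa + U a⟫ < 0` and hence `⟪a, U a⟫ < −γR²` (fast inflow) and `|U a| > γR`. [cite: Chae2007CMPEuler, Thm 2.2 + Note added p. 6] -/
theorem exists_swirlMax_inflow (h : IsSelfSimilarEulerProfile γ 0 U P) (hU : IsAxisymmetric U) (hγ0 : 0 ≤ γ) (hγ2 : γ < 1 / 2)
    {R : ℝ} (hR : ∃ y ∈ closedBall (0 : EuclideanSpace ℝ (Fin 3)) R, swirl U y ≠ 0) :
    ∃ a : EuclideanSpace ℝ (Fin 3), ‖a‖ = R ∧ swirl U a ≠ 0 ∧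
      (∀ y ∈ closedBall (0 : EuclideanSpace ℝ (Fin 3)) R, |swirl U y| ≤ |swirl U a|) ∧
      ⟪a, selfSimilarTransport γ 0 U a⟫ < 0 ∧ ⟪a, U a⟫ < -(γ * R ^ 2) ∧ γ * R < ‖U a‖ := by
  obtain ⟨y, hy, hyΓ⟩ := hR
  have hΓc : Continuous (swirl U) := (contDiff_swirl h.contDiff_velocity).continuous
  obtain ⟨a, ha, hmax⟩ := (isCompact_closedBall (0 : EuclideanSpace ℝ (Fin 3)) R).exists_isMaxOn ⟨y, hy⟩ (hΓc.pow 2).continuousOn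
  have hΓa : swirl U a ≠ 0 := by
    intro h0
    have h1 : swirl U y ^ 2 ≤ swirl U a ^ 2 := hmax hy
    rw [h0] at h1
    exact hyΓ (pow_eq_zero_iff two_ne_zero |>.1 (le_antisymm (by simpa using h1) (sq_nonneg _)))
  obtain ⟨hRa, hin⟩ := swirlMax_boundary_inflow h hU hγ2 ha hmax hΓa
  have hUa : ⟪a, U a⟫ < -(γ * R ^ 2) := by
    rw [selfSimilarTransport_apply, sub_zero, inner_add_right, real_inner_smul_right, real_inner_self_eq_norm_sq, hRa] at hin
    linarith
  have ha0 : a ≠ 0 := by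
    intro h0; apply hΓa; rw [h0]; simp [swirl]
  have hR0 : 0 < R := by rw [← hRa]; exact norm_pos_iff.2 ha0
  refine ⟨a, hRa, hΓa, fun z hz => sq_le_sq.1 (hmax hz), hin, hUa, ?_⟩
  -- `γR² < −⟪a, U a⟫ ≤ ‖a‖‖U a‖ = R‖U a‖`
  have hcs : |⟪a, U a⟫| ≤ ‖a‖ * ‖U a‖ := abs_real_inner_le_norm _ _
  rw [hRa] at hcs
  have h1 : γ * R ^ 2 < R * ‖U a‖ := by
    have h2 : γ * R ^ 2 < |⟪a, U a⟫| := by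
      rw [abs_of_neg (by nlinarith [pow_pos hR0 2])]; linarith
    exact h2.trans_le hcs
  nlinarith

/-- **SWIRL PIERCING**: an axisymmetric `C²` self-similar profile WITH swirl (`0 ≤ γ < ½`) carries, on EVERY sphere `S_R` beyond the swirl onset, a fast-inflow point
(`⟪a, U a⟫ < −γR²`, so `|U a| > γR`) at which `|rU_θ|` attains its maximum over the ball `‖y‖ ≤ R` — the swirl channel is an inflow channel.  No growth, tameness or
pressure hypothesis. [cite: Chae2007CMPEuler, Thm 2.2 + Note added p. 6] -/
theorem swirl_piercing (h : IsSelfSimilarEulerProfile γ 0 U P) (hU : IsAxisymmetric U) (hγ0 : 0 ≤ γ) (hγ2 : γ < 1 / 2)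
    (hsw : ¬ HasNoSwirl U) :
    ∃ R₁ : ℝ, ∀ R : ℝ, R₁ ≤ R → ∃ a : EuclideanSpace ℝ (Fin 3), ‖a‖ = R ∧ swirl U a ≠ 0 ∧
      (∀ y ∈ closedBall (0 : EuclideanSpace ℝ (Fin 3)) R, |swirl U y| ≤ |swirl U a|) ∧
      ⟪a, selfSimilarTransport γ 0 U a⟫ < 0 ∧ ⟪a, U a⟫ < -(γ * R ^ 2) ∧ γ * R < ‖U a‖ := by
  simp only [HasNoSwirl, not_forall] at hsw
  obtain ⟨y₀, hy₀⟩ := hsw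
  refine ⟨‖y₀‖, fun R hR => exists_swirlMax_inflow h hU hγ0 hγ2 ⟨y₀, mem_closedBall_zero_iff.2 hR, hy₀⟩⟩

/-- **The ball maximum of the swirl is STRICTLY increasing in the radius beyond the onset**: if `a′` maximises `|Γ|` over `‖y‖ ≤ R′` with `Γ(a′) ≠ 0` and `R′ < R`,
some point of the ball `‖y‖ ≤ R` has strictly larger `|Γ|` (else `a′` would be an interior maximiser for the bigger ball). [folklore] -/
theorem swirlMax_lt_of_lt (h : IsSelfSimilarEulerProfile γ 0 U P) (hU : IsAxisymmetric U) (hγ2 : γ < 1 / 2)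
    {R' R : ℝ} (hR : R' < R) {a' : EuclideanSpace ℝ (Fin 3)} (ha' : a' ∈ closedBall (0 : EuclideanSpace ℝ (Fin 3)) R')
    (hΓ : swirl U a' ≠ 0) :
    ∃ y ∈ closedBall (0 : EuclideanSpace ℝ (Fin 3)) R, |swirl U a'| < |swirl U y| := by
  by_contra hno'
  have hno : ∀ y ∈ closedBall (0 : EuclideanSpace ℝ (Fin 3)) R, |swirl U y| ≤ |swirl U a'| :=
    fun y hy => le_of_not_gt fun hlt => hno' ⟨y, hy, hlt⟩
  have ha'R : a' ∈ closedBall (0 : EuclideanSpace ℝ (Fin 3)) R := closedBall_subset_closedBall hR.le ha'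
  have hmax : IsMaxOn (fun y => swirl U y ^ 2) (closedBall (0 : EuclideanSpace ℝ (Fin 3)) R) a' :=
    fun y hy => sq_le_sq.2 (hno y hy)
  have h1 := (swirlMax_boundary_inflow h hU hγ2 ha'R hmax hΓ).1
  have h2 : ‖a'‖ ≤ R' := mem_closedBall_zero_iff.1 ha'
  linarith

end SwirlRatchet

end Summit.NavierStokesRegularity.NavierStokesRegularity.Theorems.PowerGaugeEulerLiouville

end
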